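import Summits.BirchSwinnertonDyer.BirchSwinnertonDyer.Theorems.ByReductionTypeAtTwoLevel3Class421590bo
import Summits.BirchSwinnertonDyer.BirchSwinnertonDyer.Theorems.ByReductionTypeAtTwoLevel3Classes188538x452298bo
import Summits.BirchSwinnertonDyer.BirchSwinnertonDyer.Theorems.ByReductionTypeAtTwoLevel2Class225330bb
import Summits.BirchSwinnertonDyer.Rank1Residual.X5.TwoAdicTargetsMultPubOdd
import HarnessLib

/-!
# Route `ByReductionTypeAtTwo`, item stmt-BirchSwinnertonDyer-19923 `MultLowerHalfAtTwo`: the two-lane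
# class road («Kato above, descent below») and its four class instances RE-TYPED on the guarded twin of
# Greenberg's non-split display (audit N-1)

Twin of `Theorems/ByReductionTypeAtTwoMultLowerHalfDescent.lean` §3 (p422308) and of the class files
`…Level3Class421590bo` (p422889), `…Level3Classes188538x452298bo` (p424015), `…Level2Class225330bb`
(p424590) — seat bsd-2adic-mult-3 GEN 2 — and, because the two-lane door consumes it, of mult-2's
upper-half road `missingUpperBoundAt_two_mult_of_mu_eq_zero_of_period` /
`missingUpperBoundAt_two_mult_of_roadMember` (p418902). All of these display the PRINT binder
`(h41ns : A235)`, A235 = `Greenberg1999.thm41Analogue_charValue_rankZero_numberField_anyPrime`, which the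
cell's D-audit (bsd-2adic-audit-1 GEN 3, `HOME/audit/D-AUDIT-h41-Gr99-Thm41-mult-analogue-at-2.md`
@f526883ecb786716, V2) found CONTRADICTED by its source as a `∀ F` statement (LNM 1716 §3 Note, held copy
chunk p0093 L15). Remedy N-1(b): the binder is re-typed to the guarded twin `…_anyPrime_oddLocalDegree`
(p425330) through the primed glue `X5.O1.twoAdicEulerCharRankZeroNonsplitMult_zero_of_greenberg'`
(p428013). Every other binder, every conclusion and every kernel-decided curve datum (Prop-5.14 points,
`Mult`, Vélu certificates — imported from the class files, not re-derived) is unchanged; the unprimed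
theorems stay and are DERIVED from these (`…_oddLocalDegree_of_anyPrime`).

* §1 `missingUpperBoundAt_two_mult_of_mu_eq_zero_of_period'`, `missingUpperBoundAt_two_mult_of_roadMember'`
  (twins of p418902 §3/§4; non-split branch through `X5.O1.missingUpperBoundAt_two_nonsplit_of_mu_eq_zero_auto`).
* §2 `bsdp_two_mult_of_roadMember_of_levelMember'` (twin of p422308 §3).
* §3 `L3C421590bo.bsdp_two_class'`, `L3C188538x452298bo.bsdp_two_class_188538x'`,
  `L3C188538x452298bo.bsdp_two_class_452298bo'`, `L2C225330bb.bsdp_two_class'` — the four per-class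
  CANDIDATES (evidence `CANDIDATES-mult-twolane.md` on item 19923) now displayable PROVED-by-name on the
  twin: PRINT {twin `h41ns`, A236 `h41sp`, `hmod`, `hL`, `hGZK`, `hCassels`, `h514`, `hC`} + MEMO {`hKato`
  RC-2, `hGS` RC-4} + CERT/RECORD {`hper₀`, `hr`, `hq`, `hdvd`}.

HONEST FRAMING (cell bsd-2adic): COMPOSITION certificates; research inputs stay hypotheses; the item is
NOT closed; no class is booked by this file (booking = referee); BSD is not proved by any of this.
PARTITION: X5@2 mult (K4ᵐ, RESIDUAL-MAP B1·O1; 1 976 book230 classes) × p = 2 — types-the-object-of (item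
19923 per class; PRINT binder hygiene on 4 candidate classes); closes none.
[cite: GreenbergLNM1716, Prop. 5.14 (p. 121), §4 pp. 112–113 and §3] [cite: Kato2004Asterisque, Thm. 17.4 (p. 273)]
[cite: Cesnavicius2018, Thm. 1.2] [cite: Cassels1965ArithmeticVIII] [cite: Miller2011LMS, Def. 1.1]
-/

set_option autoImplicit false
-- the route's Theorems namespace `Summit.BirchSwinnertonDyer.BirchSwinnertonDyer.Theorems` repeats a
-- component by design (summit = sub-problem, D-0017); same justification as p418902 / p422308.
set_option linter.dupNamespace false

noncomputable section

open scoped Classical MatrixGroups ModularForm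

open CongruenceSubgroup WeierstrassCurve Literature.NumberTheory.EllipticCurves
  Literature.NumberTheory.EllipticCurves.ModularForms
  Literature.NumberTheory.EllipticCurves.Greenberg1999
  Literature.NumberTheory.EllipticCurves.Rank1Residual
  Literature.NumberTheory.EllipticCurves.Rank1Residual.Typed
  Summit.BirchSwinnertonDyer.Rank1Residual.X5

namespace Summit.BirchSwinnertonDyer.BirchSwinnertonDyer.Theorems

/-! ## §1 The upper-half road at ONE member, on the twin (twins of p418902 §3–§4) -/

/-- **Upper half at a multiplicative `2` from `μ = 0` and a period datum, on the twin.** Twin of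
`missingUpperBoundAt_two_mult_of_mu_eq_zero_of_period` (p418902) with `h41ns` re-typed to
`…_anyPrime_oddLocalDegree`: non-split branch = `X5.O1.missingUpperBoundAt_two_nonsplit_of_mu_eq_zero_auto`
fed by the primed glue; split branch verbatim (A236). Binders otherwise unchanged: `hKato` (RC-2,
projected onto K11a/K11b-Rat), `hGS` (RC-4, `κ₁` by `O1.kappaOne_binder_of_greenbergStevens`), `hμ`,
`hper₀`. Composition; nothing asserted. [cite: GreenbergLNM1716, §4 pp. 112–113 and §3]
[cite: Kato2004Asterisque, Thm. 17.4 and 17.13] [cite: Miller2011LMS, Def. 1.1] -/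
theorem missingUpperBoundAt_two_mult_of_mu_eq_zero_of_period' (W : WeierstrassCurve ℚ)
    [W.IsElliptic] [W.IsGloballyMinimal] (hKato : O1.KatoMultiplicativeDivisibilityRat W 2)
    (h41ns : thm41Analogue_charValue_rankZero_numberField_anyPrime_oddLocalDegree)
    (h41sp : thm41Analogue_charValue_rankZero_split_baseChange_anyPrime)
    (hmod : nonempty_modularParametrizationData)
    (hGZK : rank_eq_analyticRank_of_analyticRank_le_one)
    (hGS : W.HasSplitMultiplicativeReductionAtPrime 2 → greenberg_stevens (W := W) (p := 2))
    (hμ : ∀ (κ : ZpExtension ℚ 2) (γ : Field.absoluteGaloisGroup ℚ), κ.IsCyclotomic →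
      κ.IsTopGenerator γ → IsCyclotomicVariable 2 γ → ∀ D : W.SelmerDualData κ γ, D.mu = 0)
    (hper₀ : ∀ [NeZero (W.conductorNorm ℤ)] (f : CuspForm (Gamma0 (W.conductorNorm ℤ)) 2),
      IsNewformOf W f → ∀ ϖ : ℚ, (ϖ : ℝ) * W.realPeriodRat = plusPeriod f → 0 ≤ padicValRat 2 ϖ)
    (hr : W.analyticRank = 0) (hmult : Mult W 2) : MissingUpperBoundAt W 2 := by
  by_cases hsp : W.HasSplitMultiplicativeReductionAtPrime 2
  · exact O1.missingUpperBoundAt_two_split_of_mu_eq_zero_auto W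
      (O1.twoAdicEulerCharRankZeroSplitMult_zero_of_greenberg W h41sp) hmod hGZK
      (fun f L => O1.katoDivisibilityAtTwoSplitMultRat_of_multRat W hKato f L) hμ
      (O1.kappaOne_binder_of_greenbergStevens W (hGS hsp) hr) hper₀ hr hmult hsp
  · exact O1.missingUpperBoundAt_two_nonsplit_of_mu_eq_zero_auto W
      (O1.twoAdicEulerCharRankZeroNonsplitMult_zero_of_greenberg' W h41ns) hmod hGZK
      (fun f L => O1.katoDivisibilityAtTwoNonsplitMultRat_of_multRat W hKato f L) hμ hper₀ hr hmult
      hsp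

/-- **The upper half at a multiplicative `2` from ONE road member of the isogeny class, on the twin.**
Twin of `missingUpperBoundAt_two_mult_of_roadMember` (p418902) with `h41ns` re-typed: for `W` of analytic
rank `0` multiplicative at `2` and a globally minimal `W₁ ~_ℚ W` with (A) `μ = 0` for every cyclotomic
dual datum OR a Prop-5.14 point on `W₁` (then `μ = 0` is PRINT, `h514`) and (B) `E₁[2]` irreducible OR
an `X₀(N)`-optimal parametrisation datum OR `0 ≤ ord₂ ϖ` directly, `MissingUpperBoundAt W 2` holds; the
class data move to `W₁`, §1 gives the upper half there, Cassels (`X12.missingUpperBoundAt_of_isIsogenous`)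
carries it to `W`. [cite: GreenbergLNM1716, Prop. 5.14 (p. 121) and §4 pp. 112–113]
[cite: Cesnavicius2018, Thm. 1.2] [cite: Cassels1965ArithmeticVIII] [cite: Miller2011LMS, §1 and Def. 1.1] -/
theorem missingUpperBoundAt_two_mult_of_roadMember'
    (hKato : ∀ (W : WeierstrassCurve ℚ) [W.IsElliptic] [W.IsGloballyMinimal],
      ¬ W.HasCM → Mult W 2 → O1.KatoMultiplicativeDivisibilityRat W 2)
    (h41ns : thm41Analogue_charValue_rankZero_numberField_anyPrime_oddLocalDegree)
    (h41sp : thm41Analogue_charValue_rankZero_split_baseChange_anyPrime)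
    (hmod : nonempty_modularParametrizationData)
    (hGZK : rank_eq_analyticRank_of_analyticRank_le_one)
    (hCassels : bsdRHS_eq_of_isIsogenous)
    (h514 : prop514_isTorsion_mu_eq_zero_two)
    (hC : cesnavicius_not_two_dvd_maninConstant_of_two_dvd_level)
    (hGS : ∀ (W : WeierstrassCurve ℚ) [W.IsElliptic] [W.IsGloballyMinimal],
      W.HasSplitMultiplicativeReductionAtPrime 2 → greenberg_stevens (W := W) (p := 2))
    (W : WeierstrassCurve ℚ) [W.IsElliptic] [W.IsGloballyMinimal]
    (hr : W.analyticRank = 0) (hmult : Mult W 2)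
    (W₁ : WeierstrassCurve ℚ) [W₁.IsElliptic] [W₁.IsGloballyMinimal] (hiso : IsIsogenous W W₁)
    (hA : (∀ (κ : ZpExtension ℚ 2) (γ : Field.absoluteGaloisGroup ℚ), κ.IsCyclotomic →
        κ.IsTopGenerator γ → IsCyclotomicVariable 2 γ → ∀ D : W₁.SelmerDualData κ γ, D.mu = 0) ∨
      (∃ x y : ℚ, W₁.toAffine.Equation x y ∧ 2 * y + W₁.a₁ * x + W₁.a₃ = 0 ∧
        ((TwoTorsionRamifiedAtTwo x ∧ ¬ TwoTorsionOdd W₁ x) ∨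
          (TwoTorsionOdd W₁ x ∧ ¬ TwoTorsionRamifiedAtTwo x))))
    (hB : Irr W₁ 2 ∨
      (∀ [NeZero (W₁.conductorNorm ℤ)],
        ∃ D : ModularParametrizationData W₁ (W₁.conductorNorm ℤ), Zhai2021.IsOptimalDatum W₁ D) ∨
      (∀ [NeZero (W₁.conductorNorm ℤ)] (f : CuspForm (Gamma0 (W₁.conductorNorm ℤ)) 2),
        IsNewformOf W₁ f → ∀ ϖ : ℚ, (ϖ : ℝ) * W₁.realPeriodRat = plusPeriod f →
          0 ≤ padicValRat 2 ϖ)) :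
    MissingUpperBoundAt W 2 := by
  -- the class data at `W₁`
  have hmult₁ : Mult W₁ 2 :=
    Summit.BirchSwinnertonDyer.Rank1Residual.X2.IsogenyQuotientLine.hasMultiplicativeReductionAtPrime_of_isIsogenous
      hiso hmult
  have hr₁ : W₁.analyticRank = 0 := (analyticRank_eq_of_isIsogenous' hiso).symm.trans hr
  have hcm₁ : ¬ W₁.HasCM := fun h ↦ Rank1Residual.not_mult_of_hasCM W₁ h 2 hmult₁
  -- (A) `μ = 0` at `W₁`
  have hμ₁ : ∀ (κ : ZpExtension ℚ 2) (γ : Field.absoluteGaloisGroup ℚ), κ.IsCyclotomic →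
      κ.IsTopGenerator γ → IsCyclotomicVariable 2 γ → ∀ D : W₁.SelmerDualData κ γ, D.mu = 0 := by
    rcases hA with hμ | ⟨x, y, hP, h2, hΦ⟩
    · exact hμ
    · exact fun _ _ hκ hγ _ D ↦ (h514.of_mult W₁ hmult₁ hP h2 hΦ hκ hγ D).2
  -- (B) `0 ≤ ord₂ ϖ` at `W₁`
  have hper₁ : ∀ [NeZero (W₁.conductorNorm ℤ)] (f : CuspForm (Gamma0 (W₁.conductorNorm ℤ)) 2),
      IsNewformOf W₁ f → ∀ ϖ : ℚ, (ϖ : ℝ) * W₁.realPeriodRat = plusPeriod f →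
        0 ≤ padicValRat 2 ϖ := by
    rcases hB with hirr | hopt | hper
    · intro _ f hf ϖ hϖ
      exact (padicValRat_periodRatio_eq_zero_of_irr_two hC W₁ hmult₁ hirr f hf ϖ hϖ).ge
    · intro _ f hf ϖ hϖ
      obtain ⟨D, hD⟩ := hopt
      exact (padicValRat_periodRatio_eq_zero_of_isOptimalDatum hC W₁ hmult₁ D hD f hf ϖ hϖ).ge
    · exact hper
  -- the road at `W₁` (on the twin), then Cassels
  have hU₁ : MissingUpperBoundAt W₁ 2 :=
    missingUpperBoundAt_two_mult_of_mu_eq_zero_of_period' W₁ (hKato W₁ hcm₁ hmult₁) h41ns h41sp hmod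
      hGZK (hGS W₁) hμ₁ hper₁ hr₁ hmult₁
  haveI : NeZero (W₁.conductorNorm ℤ) := ⟨(W₁.conductorNorm_pos_holds).ne'⟩
  obtain ⟨Dm⟩ := hmod W₁
  have hlead₁ : W₁.leadingLCoeff ≠ 0 :=
    W₁.leadingLCoeff_ne_zero_holds Dm.isNewformOf.hasEntireLFunction
  have hfin₁ : Finite W₁.sha := (hGZK W₁ (by rw [hr₁]; exact zero_le_one)).2
  exact Summit.BirchSwinnertonDyer.Rank1Residual.X12.missingUpperBoundAt_of_isIsogenous hCassels hiso
    hfin₁ hlead₁ hU₁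

/-! ## §2 «Kato above, descent below» on the twin (twin of p422308 §3) -/

/-- **THE CLASS CLOSING SHAPE OF A LEVEL-3 MULTIPLICATIVE CLASS, on the twin.** Twin of
`bsdp_two_mult_of_roadMember_of_levelMember` (p422308) with `h41ns` re-typed to
`…_anyPrime_oddLocalDegree`: for `W` of analytic rank `0`, multiplicative at `2`, the UPPER half from the
road at ONE member `W₁ ~ W` (§1) and the LOWER half from a level datum at ANY member `W₂ ~ W`
(`2^m ∣ #Ш(W₂)`, `ord₂ #Ш_an(W₂) ≤ m`; `missingLowerBoundAt_two_of_levelMember`, unchanged — it displays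
no Greenberg binder) give `BSDp W 2`. [cite: Kato2004Asterisque, Thm. 17.4 (p. 273)]
[cite: GreenbergLNM1716, Prop. 5.14 and §4 pp. 112–113] [cite: Cesnavicius2018, Thm. 1.2]
[cite: Cassels1965ArithmeticVIII] [cite: SwinnertonDyer2013, §1] [cite: Miller2011LMS, Def. 1.1] -/
theorem bsdp_two_mult_of_roadMember_of_levelMember'
    (hKato : ∀ (W : WeierstrassCurve ℚ) [W.IsElliptic] [W.IsGloballyMinimal],
      ¬ W.HasCM → Mult W 2 → O1.KatoMultiplicativeDivisibilityRat W 2)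
    (h41ns : thm41Analogue_charValue_rankZero_numberField_anyPrime_oddLocalDegree)
    (h41sp : thm41Analogue_charValue_rankZero_split_baseChange_anyPrime)
    (hmod : nonempty_modularParametrizationData)
    (hGZK : rank_eq_analyticRank_of_analyticRank_le_one)
    (hCassels : bsdRHS_eq_of_isIsogenous)
    (h514 : prop514_isTorsion_mu_eq_zero_two)
    (hC : cesnavicius_not_two_dvd_maninConstant_of_two_dvd_level)
    (hGS : ∀ (W : WeierstrassCurve ℚ) [W.IsElliptic] [W.IsGloballyMinimal],
      W.HasSplitMultiplicativeReductionAtPrime 2 → greenberg_stevens (W := W) (p := 2))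
    (hL : hasEntireLFunction_rat)
    (W : WeierstrassCurve ℚ) [W.IsElliptic] [W.IsGloballyMinimal]
    (hr : W.analyticRank = 0) (hmult : Mult W 2)
    (W₁ : WeierstrassCurve ℚ) [W₁.IsElliptic] [W₁.IsGloballyMinimal] (hiso₁ : IsIsogenous W W₁)
    (hA : (∀ (κ : ZpExtension ℚ 2) (γ : Field.absoluteGaloisGroup ℚ), κ.IsCyclotomic →
        κ.IsTopGenerator γ → IsCyclotomicVariable 2 γ → ∀ D : W₁.SelmerDualData κ γ, D.mu = 0) ∨
      (∃ x y : ℚ, W₁.toAffine.Equation x y ∧ 2 * y + W₁.a₁ * x + W₁.a₃ = 0 ∧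
        ((TwoTorsionRamifiedAtTwo x ∧ ¬ TwoTorsionOdd W₁ x) ∨
          (TwoTorsionOdd W₁ x ∧ ¬ TwoTorsionRamifiedAtTwo x))))
    (hB : Irr W₁ 2 ∨
      (∀ [NeZero (W₁.conductorNorm ℤ)],
        ∃ D : ModularParametrizationData W₁ (W₁.conductorNorm ℤ), Zhai2021.IsOptimalDatum W₁ D) ∨
      (∀ [NeZero (W₁.conductorNorm ℤ)] (f : CuspForm (Gamma0 (W₁.conductorNorm ℤ)) 2),
        IsNewformOf W₁ f → ∀ ϖ : ℚ, (ϖ : ℝ) * W₁.realPeriodRat = plusPeriod f →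
          0 ≤ padicValRat 2 ϖ))
    (W₂ : WeierstrassCurve ℚ) [W₂.IsElliptic] [W₂.IsGloballyMinimal] (hiso₂ : IsIsogenous W W₂)
    {q : ℚ} (hq : shaAn W₂ = (q : ℂ)) {m : ℕ} (hv : padicValRat 2 q ≤ m)
    (hdvd : 2 ^ m ∣ W₂.shaOrder) : BSDp W 2 := by
  haveI : Fact (Nat.Prime 2) := ⟨Nat.prime_two⟩
  have hU : MissingUpperBoundAt W 2 :=
    missingUpperBoundAt_two_mult_of_roadMember' hKato h41ns h41sp hmod hGZK hCassels h514 hC hGS W hr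
      hmult W₁ hiso₁ hA hB
  have hlow : MissingLowerBoundAt W 2 :=
    missingLowerBoundAt_two_of_levelMember hGZK hCassels hL W hr W₂ hiso₂ hq hv hdvd
  exact bsdp_of_missingPPartAt W 2 hGZK (by omega) (missingPPartAt_of_lower_of_upper W 2 hlow hU)

/-! ## §3 The four candidate classes on the twin (twins of p422889 / p424015 / p424590)

The curve abbreviations, their `Mult`/Prop-5.14/ellipticity/minimality facts and the Vélu isogeny
certificates are the landed ones of the class files (`L3C421590bo.bo1 … bo4`, `L3C188538x452298bo.x1 x2
bo1 bo2`, `L2C225330bb.bb1 … bb4`); only the composition is redone with `h41ns` on the twin. -/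

/-- **`BSD(·,2)` for the whole level-3 class 421590bo (bo1–bo4; `#Ш_an = 256, 64, 64, 256`), on the
twin.** Twin of `L3C421590bo.bsdp_two_class` (p422889): both lanes at bo2 (type-B Prop-5.14 point,
`hper₀`, `hr`, `hq : #Ш_an = 64`, `hdvd : 2⁶ ∣ #Ш(bo2)`), the other members by
`O1.bsdp_two_iff_of_isIsogenous` along the kernel-checked `2`-isogenies. Nothing is booked.
[cite: Cassels1965ArithmeticVIII, Thm. 1.3 (isogeny invariance)] [cite: GreenbergLNM1716, Prop. 5.14]
[cite: SwinnertonDyer2013, §1] [cite: Miller2011LMS, Def. 1.1] -/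
theorem L3C421590bo.bsdp_two_class'
    (hKato : ∀ (W : WeierstrassCurve ℚ) [W.IsElliptic] [W.IsGloballyMinimal],
      ¬ W.HasCM → Mult W 2 → O1.KatoMultiplicativeDivisibilityRat W 2)
    (h41ns : thm41Analogue_charValue_rankZero_numberField_anyPrime_oddLocalDegree)
    (h41sp : thm41Analogue_charValue_rankZero_split_baseChange_anyPrime)
    (hmod : nonempty_modularParametrizationData)
    (hGZK : rank_eq_analyticRank_of_analyticRank_le_one)
    (hCassels : bsdRHS_eq_of_isIsogenous)
    (h514 : prop514_isTorsion_mu_eq_zero_two)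
    (hC : cesnavicius_not_two_dvd_maninConstant_of_two_dvd_level)
    (hGS : ∀ (W : WeierstrassCurve ℚ) [W.IsElliptic] [W.IsGloballyMinimal],
      W.HasSplitMultiplicativeReductionAtPrime 2 → greenberg_stevens (W := W) (p := 2))
    (hL : hasEntireLFunction_rat)
    (hper₀ : ∀ [NeZero (L3C421590bo.bo2.conductorNorm ℤ)]
      (f : CuspForm (Gamma0 (L3C421590bo.bo2.conductorNorm ℤ)) 2), IsNewformOf L3C421590bo.bo2 f →
      ∀ ϖ : ℚ, (ϖ : ℝ) * L3C421590bo.bo2.realPeriodRat = plusPeriod f → 0 ≤ padicValRat 2 ϖ)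
    (hr : L3C421590bo.bo2.analyticRank = 0) (hq : shaAn L3C421590bo.bo2 = ((64 : ℚ) : ℂ))
    (hdvd : 2 ^ 6 ∣ L3C421590bo.bo2.shaOrder) :
    BSDp L3C421590bo.bo1 2 ∧ BSDp L3C421590bo.bo2 2 ∧ BSDp L3C421590bo.bo3 2 ∧
      BSDp L3C421590bo.bo4 2 := by
  open L3C421590bo in
  have hv : padicValRat 2 (64 : ℚ) ≤ ((6 : ℕ) : ℤ) := by
    rw [show (64 : ℚ) = ((2 ^ 6 : ℕ) : ℚ) by norm_num, padicValRat.of_nat, padicValNat.prime_pow]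
  have h2 : BSDp bo2 2 :=
    bsdp_two_mult_of_roadMember_of_levelMember' hKato h41ns h41sp hmod hGZK hCassels h514 hC hGS hL
      bo2 hr mult_two_bo2 bo2 (IsIsogenous.refl_holds bo2) (Or.inr bo2_prop514)
      (Or.inr (Or.inr fun {_} f hf ϖ hϖ => hper₀ f hf ϖ hϖ)) bo2 (IsIsogenous.refl_holds bo2) hq hv hdvd
  have hr2 : bo2.analyticRank ≤ 1 := by rw [hr]; exact zero_le_one
  refine ⟨?_, h2, ?_, ?_⟩
  · exact (O1.bsdp_two_iff_of_isIsogenous bo2 hGZK hCassels hL isIsogenous_bo1_bo2.symm_of_charZero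
      hr2).mp h2
  · exact (O1.bsdp_two_iff_of_isIsogenous bo2 hGZK hCassels hL isIsogenous_bo2_bo3 hr2).mp h2
  · exact (O1.bsdp_two_iff_of_isIsogenous bo2 hGZK hCassels hL isIsogenous_bo2_bo4 hr2).mp h2

/-- **`BSD(·,2)` for the level-3 class 188538x (x1 `#Ш_an = 256`, x2 `#Ш_an = 64`; non-split at `2`),
on the twin.** Twin of `L3C188538x452298bo.bsdp_two_class_188538x` (p424015): UPPER at x1 (type-B
Prop-5.14 point; `hper₀` at the optimal x1), LOWER from the level-3 record at x2, moved along the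
kernel-checked `2`-isogeny x1 → x2. Nothing is booked. [cite: GreenbergLNM1716, Prop. 5.14 and §4 pp. 112–113]
[cite: Kato2004Asterisque, Thm. 17.4 (p. 273)] [cite: Cesnavicius2018, Thm. 1.2] [cite: Miller2011LMS, Def. 1.1] -/
theorem L3C188538x452298bo.bsdp_two_class_188538x'
    (hKato : ∀ (W : WeierstrassCurve ℚ) [W.IsElliptic] [W.IsGloballyMinimal],
      ¬ W.HasCM → Mult W 2 → O1.KatoMultiplicativeDivisibilityRat W 2)
    (h41ns : thm41Analogue_charValue_rankZero_numberField_anyPrime_oddLocalDegree)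
    (h41sp : thm41Analogue_charValue_rankZero_split_baseChange_anyPrime)
    (hmod : nonempty_modularParametrizationData)
    (hGZK : rank_eq_analyticRank_of_analyticRank_le_one)
    (hCassels : bsdRHS_eq_of_isIsogenous)
    (h514 : prop514_isTorsion_mu_eq_zero_two)
    (hC : cesnavicius_not_two_dvd_maninConstant_of_two_dvd_level)
    (hGS : ∀ (W : WeierstrassCurve ℚ) [W.IsElliptic] [W.IsGloballyMinimal],
      W.HasSplitMultiplicativeReductionAtPrime 2 → greenberg_stevens (W := W) (p := 2))
    (hL : hasEntireLFunction_rat)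
    (hper₀ : ∀ [NeZero (L3C188538x452298bo.x1.conductorNorm ℤ)]
      (f : CuspForm (Gamma0 (L3C188538x452298bo.x1.conductorNorm ℤ)) 2),
      IsNewformOf L3C188538x452298bo.x1 f →
      ∀ ϖ : ℚ, (ϖ : ℝ) * L3C188538x452298bo.x1.realPeriodRat = plusPeriod f → 0 ≤ padicValRat 2 ϖ)
    (hr : L3C188538x452298bo.x1.analyticRank = 0)
    (hq : shaAn L3C188538x452298bo.x2 = ((64 : ℚ) : ℂ))
    (hdvd : 2 ^ 6 ∣ L3C188538x452298bo.x2.shaOrder) :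
    BSDp L3C188538x452298bo.x1 2 ∧ BSDp L3C188538x452298bo.x2 2 := by
  open L3C188538x452298bo in
  have hv : padicValRat 2 (64 : ℚ) ≤ ((6 : ℕ) : ℤ) := by
    rw [show (64 : ℚ) = ((2 ^ 6 : ℕ) : ℚ) by norm_num, padicValRat.of_nat, padicValNat.prime_pow]
  have h1 : BSDp x1 2 :=
    bsdp_two_mult_of_roadMember_of_levelMember' hKato h41ns h41sp hmod hGZK hCassels h514 hC hGS hL
      x1 hr mult_two_x1 x1 (IsIsogenous.refl_holds x1) (Or.inr x1_prop514)
      (Or.inr (Or.inr fun {_} f hf ϖ hϖ => hper₀ f hf ϖ hϖ)) x2 isIsogenous_x1_x2 hq hv hdvd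
  have hr1 : x1.analyticRank ≤ 1 := by rw [hr]; exact zero_le_one
  exact ⟨h1, (O1.bsdp_two_iff_of_isIsogenous x1 hGZK hCassels hL isIsogenous_x1_x2 hr1).mp h1⟩

/-- **`BSD(·,2)` for the level-3 class 452298bo (both `#Ш_an = 64`; split at `2`), on the twin.** Twin
of `L3C188538x452298bo.bsdp_two_class_452298bo` (p424015): both lanes at bo1 (type-B point; `hper₀`;
level-3 record), bo2 by the kernel-checked `2`-isogeny; `hGS` live (split `2`). Nothing is booked.
[cite: GreenbergLNM1716, Prop. 5.14 and §4 pp. 112–113] [cite: Kato2004Asterisque, Thm. 17.4 (p. 273)]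
[cite: GreenbergStevens1993, Thm. (split multiplicative exceptional zero)] [cite: Miller2011LMS, Def. 1.1] -/
theorem L3C188538x452298bo.bsdp_two_class_452298bo'
    (hKato : ∀ (W : WeierstrassCurve ℚ) [W.IsElliptic] [W.IsGloballyMinimal],
      ¬ W.HasCM → Mult W 2 → O1.KatoMultiplicativeDivisibilityRat W 2)
    (h41ns : thm41Analogue_charValue_rankZero_numberField_anyPrime_oddLocalDegree)
    (h41sp : thm41Analogue_charValue_rankZero_split_baseChange_anyPrime)
    (hmod : nonempty_modularParametrizationData)
    (hGZK : rank_eq_analyticRank_of_analyticRank_le_one)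
    (hCassels : bsdRHS_eq_of_isIsogenous)
    (h514 : prop514_isTorsion_mu_eq_zero_two)
    (hC : cesnavicius_not_two_dvd_maninConstant_of_two_dvd_level)
    (hGS : ∀ (W : WeierstrassCurve ℚ) [W.IsElliptic] [W.IsGloballyMinimal],
      W.HasSplitMultiplicativeReductionAtPrime 2 → greenberg_stevens (W := W) (p := 2))
    (hL : hasEntireLFunction_rat)
    (hper₀ : ∀ [NeZero (L3C188538x452298bo.bo1.conductorNorm ℤ)]
      (f : CuspForm (Gamma0 (L3C188538x452298bo.bo1.conductorNorm ℤ)) 2),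
      IsNewformOf L3C188538x452298bo.bo1 f →
      ∀ ϖ : ℚ, (ϖ : ℝ) * L3C188538x452298bo.bo1.realPeriodRat = plusPeriod f → 0 ≤ padicValRat 2 ϖ)
    (hr : L3C188538x452298bo.bo1.analyticRank = 0)
    (hq : shaAn L3C188538x452298bo.bo1 = ((64 : ℚ) : ℂ))
    (hdvd : 2 ^ 6 ∣ L3C188538x452298bo.bo1.shaOrder) :
    BSDp L3C188538x452298bo.bo1 2 ∧ BSDp L3C188538x452298bo.bo2 2 := by
  open L3C188538x452298bo in
  have hv : padicValRat 2 (64 : ℚ) ≤ ((6 : ℕ) : ℤ) := by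
    rw [show (64 : ℚ) = ((2 ^ 6 : ℕ) : ℚ) by norm_num, padicValRat.of_nat, padicValNat.prime_pow]
  have h1 : BSDp bo1 2 :=
    bsdp_two_mult_of_roadMember_of_levelMember' hKato h41ns h41sp hmod hGZK hCassels h514 hC hGS hL
      bo1 hr mult_two_bo1 bo1 (IsIsogenous.refl_holds bo1) (Or.inr bo1_prop514)
      (Or.inr (Or.inr fun {_} f hf ϖ hϖ => hper₀ f hf ϖ hϖ)) bo1 (IsIsogenous.refl_holds bo1) hq hv hdvd
  have hr1 : bo1.analyticRank ≤ 1 := by rw [hr]; exact zero_le_one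
  exact ⟨h1, (O1.bsdp_two_iff_of_isIsogenous bo1 hGZK hCassels hL isIsogenous_bo1_bo2 hr1).mp h1⟩

/-- **`BSD(·,2)` for the whole level-2 class 225330bb (bb1–bb4; `#Ш_an = 64, 16, 64, 64`), on the
twin.** Twin of `L2C225330bb.bsdp_two_class` (p424590): both lanes at bb2 (type-B point; `hper₀`; level-2
datum `hq : #Ш_an = 16`, `hdvd : 2⁴ ∣ #Ш(bb2)`), the other members by `O1.bsdp_two_iff_of_isIsogenous`
along the kernel-checked Vélu `2`-isogenies. Nothing is booked.
[cite: Cassels1965ArithmeticVIII, Thm. 1.3 (isogeny invariance)] [cite: GreenbergLNM1716, Prop. 5.14]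
[cite: MerrimanSiksekSmart1996, §4] [cite: Miller2011LMS, Def. 1.1] -/
theorem L2C225330bb.bsdp_two_class'
    (hKato : ∀ (W : WeierstrassCurve ℚ) [W.IsElliptic] [W.IsGloballyMinimal],
      ¬ W.HasCM → Mult W 2 → O1.KatoMultiplicativeDivisibilityRat W 2)
    (h41ns : thm41Analogue_charValue_rankZero_numberField_anyPrime_oddLocalDegree)
    (h41sp : thm41Analogue_charValue_rankZero_split_baseChange_anyPrime)
    (hmod : nonempty_modularParametrizationData)
    (hGZK : rank_eq_analyticRank_of_analyticRank_le_one)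
    (hCassels : bsdRHS_eq_of_isIsogenous)
    (h514 : prop514_isTorsion_mu_eq_zero_two)
    (hC : cesnavicius_not_two_dvd_maninConstant_of_two_dvd_level)
    (hGS : ∀ (W : WeierstrassCurve ℚ) [W.IsElliptic] [W.IsGloballyMinimal],
      W.HasSplitMultiplicativeReductionAtPrime 2 → greenberg_stevens (W := W) (p := 2))
    (hL : hasEntireLFunction_rat)
    (hper₀ : ∀ [NeZero (L2C225330bb.bb2.conductorNorm ℤ)]
      (f : CuspForm (Gamma0 (L2C225330bb.bb2.conductorNorm ℤ)) 2), IsNewformOf L2C225330bb.bb2 f →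
      ∀ ϖ : ℚ, (ϖ : ℝ) * L2C225330bb.bb2.realPeriodRat = plusPeriod f → 0 ≤ padicValRat 2 ϖ)
    (hr : L2C225330bb.bb2.analyticRank = 0) (hq : shaAn L2C225330bb.bb2 = ((16 : ℚ) : ℂ))
    (hdvd : 2 ^ 4 ∣ L2C225330bb.bb2.shaOrder) :
    BSDp L2C225330bb.bb1 2 ∧ BSDp L2C225330bb.bb2 2 ∧ BSDp L2C225330bb.bb3 2 ∧
      BSDp L2C225330bb.bb4 2 := by
  open L2C225330bb in
  have hv : padicValRat 2 (16 : ℚ) ≤ ((4 : ℕ) : ℤ) := by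
    rw [show (16 : ℚ) = ((2 ^ 4 : ℕ) : ℚ) by norm_num, padicValRat.of_nat, padicValNat.prime_pow]
  have h2 : BSDp bb2 2 :=
    bsdp_two_mult_of_roadMember_of_levelMember' hKato h41ns h41sp hmod hGZK hCassels h514 hC hGS hL
      bb2 hr mult_two_bb2 bb2 (IsIsogenous.refl_holds bb2) (Or.inr bb2_prop514)
      (Or.inr (Or.inr fun {_} f hf ϖ hϖ => hper₀ f hf ϖ hϖ)) bb2 (IsIsogenous.refl_holds bb2) hq hv hdvd
  have hr2 : bb2.analyticRank ≤ 1 := by rw [hr]; exact zero_le_one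
  refine ⟨?_, h2, ?_, ?_⟩
  · exact (O1.bsdp_two_iff_of_isIsogenous bb2 hGZK hCassels hL isIsogenous_bb1_bb2.symm_of_charZero
      hr2).mp h2
  · exact (O1.bsdp_two_iff_of_isIsogenous bb2 hGZK hCassels hL isIsogenous_bb2_bb3 hr2).mp h2
  · exact (O1.bsdp_two_iff_of_isIsogenous bb2 hGZK hCassels hL isIsogenous_bb2_bb4 hr2).mp h2

end Summit.BirchSwinnertonDyer.BirchSwinnertonDyer.Theorems

end
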